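import Mathlib
import HarnessLib
import Literature.MathematicalPhysics.QuantumLattice.SectorisedKernelNormResectorisation
import Summits.HubbardSuperconductivity.HubbardSuperconductivity.Theorems.KLProgrammeKLRegimeEngineNormsStepDoorDB
import Summits.HubbardSuperconductivity.HubbardSuperconductivity.Theorems.KLProgrammeKLRegimeSectorSliceGramRegime
import Summits.HubbardSuperconductivity.HubbardSuperconductivity.Theorems.KLProgrammeH10TwoPointLimitSectorMultiplierOverlapRegime

/-!
# Route `KLProgramme` — ENGINE child stmt-HubbardSuperconductivity-20236 `KLRegimeEngineV16`, stub (b) `stub_engine_step_norms`: the norms-step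
# door UNDER THE STUB'S OWN BINDERS, with the Gram constant and the overlap constants DISCHARGED by name

Cell gate-hubbard-kl, seat hubbard-kl-r2d-p2 (g4); sequel of `…NormsStepDoor` / `…NormsStepDoorDB`.  Of the door's named slice constants, two are
in the tree under EXACTLY the binders of `stub_engine_step_norms` (`P.WF`, `R.WF2`, `0 < c ≤ klEngC₃3 P R`, `μ ∈ klWindowC`, `0 < U ≤ klEngU₀4 P R c`,
`klBetaMin ≤ β ≤ e^{c/U²}`, `FrameOK R U (nScales β) μ K`, `klEngL₃ β U ≤ L`, `klEngM₃ β U L ≤ M`):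

* the Gram datum of the sectorised slice `S(F̃_k)ᵀ·klSliceCov (k+2)·S(F̃_k)`: k3c2-p3's `TorusFourierL2.gram_entry_klSliceCov_bgmFat_klEng`
  (…SectorSliceGramRegime, p515376) — `IsGramBoundedR … √(Cκ·(Λ_k/Λ_{k+2})·e₀·8^{−k})` for `1 ≤ k ≤ nScales β + 1` (ONE absolute `Cκ`);
* the overlap constants of the pairs `(klAnisoFamily (k+1), F̃_k)` and `(klAnisoFamily (k+2), F̃_{k+1})`: p4's
  `TorusFourierL2.overlap_sums_klAniso_bgmFat_klEng` (…H10TwoPointLimitSectorMultiplierOverlapRegime) — `cr = C_B·M/β`, `cc = 2C_B·M/β` (ONE absolute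
  `C_B`), so that with the integration weight `ε_x = β/(2M)` every product `ε_x·cr`, `ε_x·cc` is the M-, β-, L-, scale-free number `C_B/2`, `C_B`.

**`klNormsStep_klEng`**: `∃ Cκ C_B > 0`, under the stub binders, for every fat index `1 ≤ k` with `k + 2 ≤ nScales β + 1`: from `Z_{k+1} ≠ 0`, a majorant
`Nin` of `ε·‖𝒱_{k+1}‖_{klAnisoFamily k, univ}` (the private invariant P(k+1)), row/column sums `≤ α` of the sectorised slice (k3c2-p3's shifted-pair α,
announced), a radius `ρ` and `θ = e·α·normV κ_k ρ Nin/κ_k² < 1` (`κ_k` the discharged Gram constant):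
(i) `Z_{k+2} ≠ 0`; (ii) P(k+2): `ε·‖𝒱_{k+2}‖_{klAnisoFamily (k+1), univ, m+1} ≤ (C_B/2)·C_B^m·ρ^{-(m+1)}·e·normV/(1−θ)`; (iii) the PUBLIC (E1-v4) left side
`ε·klAnisoLegKernelNorm … (k+2) (m+1) ≤ (C_B/2)·C_B^m·[(C_B/2)·C_B^m·ρ^{-(m+1)}·e·normV/(1−θ)]` by re-sectorisation across the plateau pair
(`Literature.…SectorisedKernelNormResectorisation.hubbardSectorKernelNorm_le_of_plateau_pair`, no second integration).
What remains named: `α` (k3c2-p3 …AlphaRegime), the induction's `Nin`/`ρ`/`θ` fit into `CE^p ε_n^{p−1} 2^{(3p−5)n}` (E1 power counting), the steps with fat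
index `0` (`𝒱_1 ↦ 𝒱_2`: Gram pack needs `N_r ≥ 2`) and `𝒱_0 ↦ 𝒱_1` (no thin plateau family) — scale-0/1 lanes.  Everything is proved; no definitions.
-/

noncomputable section

namespace Summit.HubbardSuperconductivity.HubbardSuperconductivity.Theorems.EngineV8

set_option linter.dupNamespace false -- summit = problem name (single-conjunct summit), D-0017

open Real Finset Literature.MathematicalPhysics.QuantumLattice Literature.Probability.LatticeModels GrassmannAlgebra
open Summit.HubbardSuperconductivity.HubbardSuperconductivity.Theorems.KLProgrammeLegKernels
open Summit.HubbardSuperconductivity.HubbardSuperconductivity.Theorems.KLRegimeSplit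
open Summit.HubbardSuperconductivity.HubbardSuperconductivity.Theorems.KLRegimeWick
open Summit.HubbardSuperconductivity.HubbardSuperconductivity.Theorems.TorusFourierL2

/-- The products of the integration weight with p4's overlap constants are the scale-free numbers `C_B/2`, `C_B`
(`ε_x = β/(2M)`, `cr = C_B·M/β`, `cc = 2C_B·M/β`). -/
theorem imagTimeWeight_mul_overlap_consts {β : ℝ} (hβ : 0 < β) {M : ℕ} [NeZero M] (CB : ℝ) :
    imagTimeWeight β M * (CB * M / β) = CB / 2 ∧ (2 * CB * M / β) * imagTimeWeight β M = CB := by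
  have hM : (M : ℝ) ≠ 0 := by exact_mod_cast NeZero.ne M
  unfold imagTimeWeight
  constructor
  · field_simp
  · field_simp

/-- With `cr = C_B·M/β`, `cc = 2C_B·M/β`: `ε·(cr·cc^m·ε^m·X) = (C_B/2)·C_B^m·X`. -/
theorem imagTimeWeight_mul_overlap_bound {β : ℝ} (hβ : 0 < β) {M : ℕ} [NeZero M] (CB X : ℝ) (m : ℕ) :
    imagTimeWeight β M * ((CB * M / β) * (2 * CB * M / β) ^ m * imagTimeWeight β M ^ m * X) = CB / 2 * CB ^ m * X := by
  obtain ⟨h1, h2⟩ := imagTimeWeight_mul_overlap_consts hβ (M := M) CB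
  calc imagTimeWeight β M * ((CB * M / β) * (2 * CB * M / β) ^ m * imagTimeWeight β M ^ m * X)
      = (imagTimeWeight β M * (CB * M / β)) * ((2 * CB * M / β) * imagTimeWeight β M) ^ m * X := by rw [mul_pow]; ring
    _ = CB / 2 * CB ^ m * X := by rw [h1, h2]

/-- **`klNormsStep_klEng` — the norms-step door under the binders of `stub_engine_step_norms`, Gram and overlap constants discharged.**
There are absolute constants `Cκ, C_B > 0` such that, under the stub binders, for every fat index `k` with `1 ≤ k` and `k + 2 ≤ nScales β + 1`:
from `Z_{k+1} ≠ 0`, a majorant `Nin` of the input sizes `ε·‖𝒱_{k+1}‖_{klAnisoFamily k, univ, 2m′}`, row/column sums `≤ α` of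
`S(F̃_k)ᵀ·klSliceCov (k+2)·S(F̃_k)` (`F̃_k = bgmFatMultiplier … klE0 … k`), a radius `ρ > 0` and the smallness
`e·α·normV κ_k ρ Nin/κ_k² < 1` with `κ_k = √(Cκ·(Λ_k/Λ_{k+2})·(e₀·8^{−k}))`, one gets `Z_{k+2} ≠ 0`, the private invariant at the next index
`ε·‖𝒱_{k+2}‖_{klAnisoFamily (k+1), univ, m+1} ≤ (C_B/2)·C_B^m·(ρ⁻¹^{m+1}·e·normV/(1−θ))` and the public (E1-v4) left side
`ε·klAnisoLegKernelNorm … (k+2) (m+1) ≤ (C_B/2)·C_B^m·((C_B/2)·C_B^m·(ρ⁻¹^{m+1}·e·normV/(1−θ)))`. -/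
theorem klNormsStep_klEng :
    ∃ Cκ : ℝ, 0 < Cκ ∧ ∃ CB : ℝ, 0 < CB ∧
      ∀ (P : SplitConsts) (R : RenConsts) (c : ℝ), P.WF → R.WF2 → 0 < c → c ≤ klEngC₃3 P R →
      ∀ μ ∈ klWindowC, ∀ U : ℝ, 0 < U → U ≤ klEngU₀4 P R c → ∀ β : ℝ, klBetaMin ≤ β → β ≤ Real.exp (c / U ^ 2) →
      ∀ K : TrigPolyC4v, FrameOK R U (nScales β) μ K → ∀ (L M : ℕ) [NeZero L] [NeZero M], klEngL₃ β U ≤ L → klEngM₃ β U L ≤ M →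
      ∀ k : ℕ, 1 ≤ k → k + 2 ≤ nScales β + 1 →
        klStepPartitionFn L M β U μ K (k + 1) ≠ 0 →
        ∀ Nin : ℕ → ℝ, (∀ m' : ℕ, imagTimeWeight β M *
          hubbardSectorKernelNorm L M β (klAnisoFamily L M β μ K klE0 k) (univ : Finset (Fin (2 * m') → SectorLeg (sectorCount k)))
            (klEffectiveAction L M β U μ K klE0 (k + 1)) ≤ Nin m') →
        ∀ α : ℝ, 0 < α →
          (∀ X, ∑ Y, ‖((sectorSubMatrix L M β (bgmFatMultiplier L M klE0 β (nambuXiCT L μ K) k)).transpose *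
            klSliceCov L M β μ K (k + 2) * sectorSubMatrix L M β (bgmFatMultiplier L M klE0 β (nambuXiCT L μ K) k)) X Y‖ ≤ α) →
          (∀ Y, ∑ X, ‖((sectorSubMatrix L M β (bgmFatMultiplier L M klE0 β (nambuXiCT L μ K) k)).transpose *
            klSliceCov L M β μ K (k + 2) * sectorSubMatrix L M β (bgmFatMultiplier L M klE0 β (nambuXiCT L μ K) k)) X Y‖ ≤ α) →
        ∀ ρ : ℝ, 0 < ρ →
          Real.exp 1 * α * normV (SpaceTimeIdx L M × SectorLeg (sectorCount k))
              (Real.sqrt (Cκ * (klScale klE0 k / klScale klE0 (k + 2)) * (klE0 * ((8 : ℝ) ^ k)⁻¹))) ρ Nin /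
            Real.sqrt (Cκ * (klScale klE0 k / klScale klE0 (k + 2)) * (klE0 * ((8 : ℝ) ^ k)⁻¹)) ^ 2 < 1 →
          klStepPartitionFn L M β U μ K (k + 2) ≠ 0 ∧
          (∀ m : ℕ, imagTimeWeight β M *
              hubbardSectorKernelNorm L M β (klAnisoFamily L M β μ K klE0 (k + 1))
                (univ : Finset (Fin (m + 1) → SectorLeg (sectorCount (k + 1)))) (klEffectiveAction L M β U μ K klE0 (k + 2)) ≤
            CB / 2 * CB ^ m * (ρ⁻¹ ^ (m + 1) *
              (Real.exp 1 * normV (SpaceTimeIdx L M × SectorLeg (sectorCount k))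
                (Real.sqrt (Cκ * (klScale klE0 k / klScale klE0 (k + 2)) * (klE0 * ((8 : ℝ) ^ k)⁻¹))) ρ Nin) /
              (1 - Real.exp 1 * α * normV (SpaceTimeIdx L M × SectorLeg (sectorCount k))
                (Real.sqrt (Cκ * (klScale klE0 k / klScale klE0 (k + 2)) * (klE0 * ((8 : ℝ) ^ k)⁻¹))) ρ Nin /
                Real.sqrt (Cκ * (klScale klE0 k / klScale klE0 (k + 2)) * (klE0 * ((8 : ℝ) ^ k)⁻¹)) ^ 2))) ∧
          (∀ (m : ℕ) (A : Finset (Fin (m + 1) → SectorLeg (sectorCount (k + 2)))), imagTimeWeight β M *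
              hubbardSectorKernelNorm L M β (klAnisoFamily L M β μ K klE0 (k + 2)) A (klEffectiveAction L M β U μ K klE0 (k + 2)) ≤
            CB / 2 * CB ^ m * (CB / 2 * CB ^ m * (ρ⁻¹ ^ (m + 1) *
              (Real.exp 1 * normV (SpaceTimeIdx L M × SectorLeg (sectorCount k))
                (Real.sqrt (Cκ * (klScale klE0 k / klScale klE0 (k + 2)) * (klE0 * ((8 : ℝ) ^ k)⁻¹))) ρ Nin) /
              (1 - Real.exp 1 * α * normV (SpaceTimeIdx L M × SectorLeg (sectorCount k))
                (Real.sqrt (Cκ * (klScale klE0 k / klScale klE0 (k + 2)) * (klE0 * ((8 : ℝ) ^ k)⁻¹))) ρ Nin /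
                Real.sqrt (Cκ * (klScale klE0 k / klScale klE0 (k + 2)) * (klE0 * ((8 : ℝ) ^ k)⁻¹)) ^ 2)))) := by
  obtain ⟨Cκ, hCκ, hG⟩ := gram_entry_klSliceCov_bgmFat_klEng
  obtain ⟨CB, hCB, hO⟩ := overlap_sums_klAniso_bgmFat_klEng
  refine ⟨Cκ, hCκ, CB, hCB, ?_⟩
  intro P R c hP hR hc hc3 μ hμ U hU hUle β hβ hβc K hK L M _ _ hL hM k hk1 hk2 hZ Nin hNin α hα hrow hcol ρ hρ hθ
  have hβpos : 0 < β := pos_of_klBetaMin_le hβ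
  have he : (0 : ℝ) < klE0 := by norm_num [klE0]
  have hU3 : U ≤ klEngU₀3 P R c := le_klEngU₀3_of_le_klEngU₀4 hUle
  -- the discharged Gram constant of the sectorised slice
  set κ : ℝ := Real.sqrt (Cκ * (klScale klE0 k / klScale klE0 (k + 2)) * (klE0 * ((8 : ℝ) ^ k)⁻¹)) with hκdef
  have hκ : 0 < κ := Real.sqrt_pos.2 (by
    have h1 : 0 < klScale klE0 k / klScale klE0 (k + 2) := div_pos (klth_klScale_pos _) (klth_klScale_pos _)
    positivity)
  have hGB := (hG P R c hP hR hc hc3 μ hμ U hU hUle β hβ hβc K hK L M hL hM k hk1 (by omega) (k + 2) (by omega)).2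
  -- the discharged overlap constants of the pair `(klAnisoFamily (k+1), F̃_k)`
  have hO1 := hO P R c hP hR hc hc3 μ hμ U hU hU3 β hβ hβc K hK L M hL hM (k + 1) (by omega) (by omega)
  obtain ⟨hrow1, hcol1⟩ := hO1
  have hcr0 : 0 ≤ CB * M / β := by positivity
  have hcc0 : 0 ≤ 2 * CB * M / β := by positivity
  have hε : 0 ≤ imagTimeWeight β M := imagTimeWeight_nonneg hβpos.le M
  -- the door, determinant-bound currency, output family `klAnisoFamily (k+1)`
  have hdoor := fun (m : ℕ) (A : Finset (Fin (m + 1) → SectorLeg (sectorCount (k + 1)))) =>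
    klNormsStepDB_of_sliceConsts hβpos U μ K k hZ Nin hNin hκ hGB hα hrow hcol hρ hθ (le_refl (k + 1)) hcr0 hcc0 hrow1 hcol1 m A
  -- the private invariant at the next index
  have hpriv : ∀ m : ℕ, imagTimeWeight β M *
      hubbardSectorKernelNorm L M β (klAnisoFamily L M β μ K klE0 (k + 1))
        (univ : Finset (Fin (m + 1) → SectorLeg (sectorCount (k + 1)))) (klEffectiveAction L M β U μ K klE0 (k + 2)) ≤
      CB / 2 * CB ^ m * (ρ⁻¹ ^ (m + 1) * (Real.exp 1 * normV (SpaceTimeIdx L M × SectorLeg (sectorCount k)) κ ρ Nin) /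
        (1 - Real.exp 1 * α * normV (SpaceTimeIdx L M × SectorLeg (sectorCount k)) κ ρ Nin / κ ^ 2)) := by
    intro m
    have h := mul_le_mul_of_nonneg_left (hdoor m univ).2 hε
    rwa [imagTimeWeight_mul_overlap_bound hβpos (M := M) CB _ m] at h
  refine ⟨(hdoor 0 univ).1, hpriv, fun m A => ?_⟩
  -- the public (E1-v4) quantity by re-sectorisation across the plateau pair `(klAnisoFamily (k+2), F̃_{k+1})`
  have hO2 := hO P R c hP hR hc hc3 μ hμ U hU hU3 β hβ hβc K hK L M hL hM (k + 2) (by omega) hk2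
  obtain ⟨hrow2, hcol2⟩ := hO2
  have hFF : ∀ ω p, bgmFatMultiplier L M klE0 β (nambuXiCT L μ K) (k + 1) ω p * klAnisoFamily L M β μ K klE0 (k + 1) ω p =
      klAnisoFamily L M β μ K klE0 (k + 1) ω p :=
    fun ω p => bgmFatMultiplier_mul_bgmMultiplier he β (nambuXiCT L μ K) (k + 1) ω p
  have hF0 : ∀ p, ∑ ω, klAnisoFamily L M β μ K klE0 (k + 1) ω p = 0 → ∀ ω, klAnisoFamily L M β μ K klE0 (k + 1) ω p = 0 :=
    fun p hp ω => klAnisoFamily_eq_zero_of_sum_eq_zero β μ K klE0 (k + 1) p hp ω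
  have hF'pl : ∀ (ω' : Fin (sectorCount (k + 2))) (p : FreqMomentum L M), klAnisoFamily L M β μ K klE0 (k + 2) ω' p ≠ 0 →
      ∑ ω, klAnisoFamily L M β μ K klE0 (k + 1) ω p = 1 :=
    fun ω' p h => sum_klAnisoFamily_eq_one_of_klAnisoFamily_ne_zero β μ K (le_refl (k + 2)) ω' p h
  have hre := hubbardSectorKernelNorm_le_of_plateau_pair hβpos (klAnisoFamily L M β μ K klE0 (k + 1))
    (bgmFatMultiplier L M klE0 β (nambuXiCT L μ K) (k + 1)) hFF hF0 (klAnisoFamily L M β μ K klE0 (k + 2)) hF'pl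
    (klEffectiveAction L M β U μ K klE0 (k + 2)) hcr0 hcc0 hrow2 hcol2 m A
  calc imagTimeWeight β M *
        hubbardSectorKernelNorm L M β (klAnisoFamily L M β μ K klE0 (k + 2)) A (klEffectiveAction L M β U μ K klE0 (k + 2))
      ≤ imagTimeWeight β M * (CB * M / β * (2 * CB * M / β) ^ m * imagTimeWeight β M ^ m *
          (imagTimeWeight β M * hubbardSectorKernelNorm L M β (klAnisoFamily L M β μ K klE0 (k + 1))
            (univ : Finset (Fin (m + 1) → SectorLeg (sectorCount (k + 1)))) (klEffectiveAction L M β U μ K klE0 (k + 2)))) :=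
        mul_le_mul_of_nonneg_left hre hε
    _ = CB / 2 * CB ^ m * (imagTimeWeight β M * hubbardSectorKernelNorm L M β (klAnisoFamily L M β μ K klE0 (k + 1))
            (univ : Finset (Fin (m + 1) → SectorLeg (sectorCount (k + 1)))) (klEffectiveAction L M β U μ K klE0 (k + 2))) :=
        imagTimeWeight_mul_overlap_bound hβpos (M := M) CB _ m
    _ ≤ CB / 2 * CB ^ m * (CB / 2 * CB ^ m * (ρ⁻¹ ^ (m + 1) *
          (Real.exp 1 * normV (SpaceTimeIdx L M × SectorLeg (sectorCount k)) κ ρ Nin) /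
          (1 - Real.exp 1 * α * normV (SpaceTimeIdx L M × SectorLeg (sectorCount k)) κ ρ Nin / κ ^ 2))) :=
        mul_le_mul_of_nonneg_left (hpriv m) (by positivity)

end Summit.HubbardSuperconductivity.HubbardSuperconductivity.Theorems.EngineV8

end
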